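import Summits.CriticalPhenomena.PercolationContinuityZ3.Theorems.Transplant.KNCellsBoxProdZ2ConcRootKits
import Summits.CriticalPhenomena.PercolationContinuityZ3.Theorems.Transplant.BoxProdZ2ConcReachExcess
import Summits.CriticalPhenomena.PercolationContinuityZ3.Theorems.Transplant.BoxProdZ2ConcRootHop
import Summits.CriticalPhenomena.PercolationContinuityZ3.Theorems.Transplant.KNCellsBoxProdZ2ConcScheduleG
import HarnessLib

/-!
# Design (D), residue (R) plumbing, part 2: the RIM EXCESS of the root run (entrances only from the wired root cube, fibre `≤ E₀ + 1`, via
# p3-g2's `real_rim_le_of_radius` on the fresh root world) and the RAW ROOT THEOREM **`rootOblA_concGB_raw`** = `rootOblA_of_rootRun` with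
# the kit clauses (`hkits_rootTAD`), the rim excess (`real_rim_le_root`) and the first hop (p3-g2's `root_hsrc'`) DISCHARGED — its hypotheses
# are the planar numerics `RootRunOK`, three radius facts + `rQ 0 0 ≤ E₀`, the level numerics, the counts, the inputs at the running
# parameter, the excess radius at `q`, and the first-hop prism placement (all history-free)

builds on p205010 (kernel theorem, internal audit signed; external expert review pending) — nothing in this file uses p205010.
Lane `prim-bschramm`, seat `prim-bschramm-p2` ((R) plumbing, lead g3 16:02:38Z (b)); helper file (`--supports stmt-CriticalPhenomena-4575`).

* `W0sub_eq_zero_of_not_mem_edgeSet`; **`real_rim_le_root`**; **`rootOblA_concG_raw`** (⟹ `RootOblT` by `rootOblT_of_rootOblA`).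
[cite: KozmaNitzan2024, §4 p. 27 (G₀), p. 28 ((32) at the root), Lemma 11 (pp. 22–23), Lemma 12 (p. 24)]
-/

noncomputable section

open MeasureTheory ProbabilityTheory
open scoped ENNReal Classical

namespace Summit.CriticalPhenomena.PercolationContinuityZ3.Theorems

namespace Transplant

namespace BoxProdZ2

open Literature.Probability.Percolation Literature.Probability.LatticeModels SimpleGraph GadgetSystem ProbeHistory HSiteScheme Contour KNCells
open Literature.Probability.Percolation.KozmaNitzan
open Literature.Probability.Percolation.KozmaNitzan.Cells (sgOf sgOf_sign)
open Literature.Probability.Percolation.GM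
open Literature.Barriers.CriticalPhenomena (mem_graphBall_self)
open KNLevels ChainPlanar

variable {W : Type} [DecidableEq W] [Countable W] (X : SimpleGraph W) [X.LocallyFinite]

/-! ## §1 The root law vanishes off the edges -/

omit [Countable W] in
/-- The cut root law gives weight `0` to every non-edge of `X □ ℤ²`. [folklore] -/
theorem W0sub_eq_zero_of_not_mem_edgeSet (C : PCells) (w₀ : W) (Λ : ConcRadiiG) (q : unitInterval) (δc : ℝ) (U' : Finset (W × Site 2))
    {e : Sym2 (W × Site 2)} (he : e ∉ (X □ zdGraph 2).edgeSet) :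
    (concSchemeG X C w₀ Λ q δc).W0sub (X □ zdGraph 2) U' e = 0 := by
  by_cases hU : e ∈ wireSet (↑U' : Set (W × Site 2))
  · have hF : e ∉ (concSchemeG X C w₀ Λ q δc).U₀ (X □ zdGraph 2) := by
      intro h'
      rw [KSchA.U₀, mem_edgesIn_iff] at h'
      exact he h'.1
    rw [KSchA.W0sub_apply_of_mem hU hF, KNLevels.lattW_apply, if_neg he]
  · unfold KSchA.W0sub
    exact restrW_apply_of_not_mem _ hU

/-! ## §2 The rim excess of the root run -/

section Root

variable {C : PCells} {w₀ : W} {Λ : ConcRadiiG} {q : unitInterval} {δc : ℝ} {Rt L' t R' ℓ₀ Rlev N j₀ j₁ : ℕ} {du : MDir} {ca cb q' : ℤ}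

omit [DecidableEq W] [Countable W] in
/-- A neighbour of a vertex with fibre in `B(w₀, R)` has fibre in `B(w₀, R + 1)`. [folklore] -/
theorem fst_mem_ballFin_succ_of_adj_root {R : ℕ} {a b : W × Site 2} (hadj : (X □ zdGraph 2).Adj a b) (ha : a.1 ∈ ballFin X w₀ R) :
    b.1 ∈ ballFin X w₀ (R + 1) := by
  rcases boxProd_adj.1 hadj with ⟨h1, -⟩ | ⟨-, h2⟩
  · exact mem_ballFin_succ_of_adj X ha h1
  · rw [← h2]; exact ballFin_mono X w₀ (Nat.le_succ R) ha

/-- **THE RIM EXCESS OF THE ROOT RUN**: under the cut root law, `P(⋃_{t ∈ Rim_k} root ↔ t) ≤ η` for every step `k ≤ 44`, given the excess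
radius `R₁ ≤ Rt - L'` at the running parameter for entrances at fibre `E₀ + 1` (the wired root cube has fibre radius `rQ 0 0 ≤ E₀`).
[cite: KozmaNitzan2024, §4 Lemma 12 (p. 24), p. 28] -/
theorem real_rim_le_root (h : RootRunOK C t R' ℓ₀ ca cb q') (hRB : Rt ≤ Λ.rB 0 0 du) (hRQ : Rt ≤ Λ.rQ 0 ((0 : Site 2) + stepVec du))
    {E₀ : ℕ} (hQ0 : Λ.rQ 0 0 ≤ E₀) {η : ℝ} {R₁ : ℕ}
    (hR₁ : ∀ R'', R₁ ≤ R'' → ∀ τ ∈ ({w₀} : Finset W), ∀ (Rw : ℕ) (D' A' : Finset (W × Site 2)),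
      D' ⊆ ballFin X τ Rw ×ˢ box 2 (25 * C.r) → A' ⊆ D' → (∀ a ∈ A', a.1 ∈ ballFin X τ (E₀ + 1)) →
      (bondPercolation (X □ zdGraph 2) q).real (excess X τ R'' D' A') ≤ η)
    (hR : R₁ ≤ Rt - L') {k : ℕ} (hk : k ≤ 44) :
    (prodBernoulli ((concSchemeG X C w₀ Λ q δc).W0sub (X □ zdGraph 2) (rootU X C w₀ Λ q δc Rt du))).real
      (⋃ z ∈ (rootTAD X w₀ Rt L' du t R' ℓ₀ ca cb q' Rlev N j₀ j₁ (rootU X C w₀ Λ q δc Rt du)).Rim k,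
        openConn ((w₀, (0 : Site 2)) : W × Site 2) z) ≤ η := by
  set S := concSchemeG X C w₀ Λ q δc with hSdef
  set U' := rootU X C w₀ Λ q δc Rt du with hU'
  set P := rootTAD X w₀ Rt L' du t R' ℓ₀ ca cb q' Rlev N j₀ j₁ U' with hP
  set D : Finset (W × Site 2) := U' \ S.Γ.Q S.Γ.a₀ 0 with hD
  have hrootQ : ((w₀, (0 : Site 2)) : W × Site 2) ∈ S.Γ.Q S.Γ.a₀ 0 := by
    change (w₀, (0 : Site 2)) ∈ ballFin X w₀ (Λ.rQ 0 0) ×ˢ C.Q 0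
    exact Finset.mem_product.2 ⟨(mem_ballFin X).2 (mem_graphBall_self X w₀ _), C.zero_mem_Q_zero⟩
  -- the fresh root world is a subbox of the tube graph
  have hWD : KNLevels.IsSubbox (tubeGraph X (ballFin X w₀ Rt)) (S.W0sub (X □ zdGraph 2) U') q D :=
    KSchA.isSubbox_W0sub_tube X (S := S) (ballFin X w₀ Rt) (U := S.U0root du) Finset.sdiff_subset Finset.sdiff_disjoint
  have hDπ : ∀ v ∈ D, v.1 ∈ ballFin X w₀ Rt := fun v hv => (Finset.mem_filter.1 (Finset.mem_sdiff.1 hv).1).2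
  have hWG : ∀ e, e ∉ (X □ zdGraph 2).edgeSet → S.W0sub (X □ zdGraph 2) U' e = 0 :=
    fun e he => W0sub_eq_zero_of_not_mem_edgeSet X C w₀ Λ q δc U' he
  have hroot : ((w₀, (0 : Site 2)) : W × Site 2) ∉ D := fun h' => (Finset.mem_sdiff.1 h').2 hrootQ
  have hRimD : P.Rim k ⊆ D := by
    intro z hz
    have hz' : z ∈ P.stepD k := Finset.product_subset_product_left Finset.sdiff_subset hz
    exact Finset.mem_sdiff.2 ⟨rootTAD_stepD_subset_rootU X h hRB hRQ hk hz',
      Finset.disjoint_left.1 (rootTAD_stepD_disjoint_Q X (Λ := Λ) (q := q) (δc := δc) h hk) hz'⟩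
  have hRimfar : ∀ z ∈ P.Rim k, z.1 ∉ ballFin X w₀ (Rt - L') := fun z hz =>
    (Finset.mem_sdiff.1 (Finset.mem_product.1 hz).1).2
  -- entrances come from the wired root cube
  have hA : ∀ a b, a ∉ D → b ∈ D → (X □ zdGraph 2).Adj a b → S.W0sub (X □ zdGraph 2) U' s(a, b) ≠ 0 → b.1 ∈ ballFin X w₀ (E₀ + 1) := by
    intro a b ha hb hadj hw
    have haU : a ∈ U' := by
      by_contra haU
      apply hw
      unfold KSchA.W0sub
      exact restrW_apply_of_not_mem _ (fun h' => haU (Finset.mem_coe.1 (h'.1 a (Sym2.mem_mk_left _ _))))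
    have haQ : a ∈ S.Γ.Q S.Γ.a₀ 0 := by
      by_contra haQ
      exact ha (Finset.mem_sdiff.2 ⟨haU, haQ⟩)
    have ha1 : a.1 ∈ ballFin X w₀ E₀ := by
      change a ∈ ballFin X w₀ (Λ.rQ 0 0) ×ˢ C.Q 0 at haQ
      exact ballFin_mono X w₀ hQ0 (Finset.mem_product.1 haQ).1
    exact fst_mem_ballFin_succ_of_adj_root X hadj ha1
  -- the world lies in one frame about the child's centre
  have hDbox : D ⊆ ballFin X w₀ Rt ×ˢ (box 2 (25 * C.r)).image (fun s => s + C.cen ((0 : Site 2) + stepVec du)) := by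
    intro v hv
    obtain ⟨hvU, hvQ⟩ := Finset.mem_sdiff.1 hv
    obtain ⟨hvU0, hv1⟩ := Finset.mem_filter.1 hvU
    refine Finset.mem_product.2 ⟨hv1, ?_⟩
    rcases Finset.mem_union.1 hvU0 with hvQ' | hvE
    · exact absurd hvQ' hvQ
    · change v ∈ S.Γ.Btw S.Γ.a₀ 0 du ∪ S.Γ.Q S.Γ.a₀ ((0 : Site 2) + stepVec du) at hvE
      rcases Finset.mem_union.1 hvE with hvB | hvQ2
      · change v ∈ ballFin X w₀ (Λ.rB 0 0 du) ×ˢ C.Btw 0 du at hvB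
        exact C.Btw_subset_box_image_tgt 0 du (Finset.mem_product.1 hvB).2
      · change v ∈ ballFin X w₀ (Λ.rQ 0 ((0 : Site 2) + stepVec du)) ×ˢ C.Q ((0 : Site 2) + stepVec du) at hvQ2
        exact C.Q_subset_box_image _ (Finset.mem_product.1 hvQ2).2
  exact real_rim_le_of_radius X hWD hDπ hWG hroot hRimD hRimfar hA hR₁ hR hDbox

end Root

/-! ## §3 The raw root theorem -/

/-- **THE ROOT RESIDUE OF THE CONCENTRIC SCHEME, RAW FORM** (history-free hypotheses): `RootOblA` for `concSchemeG X C w₀ Λ q δc` from, per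
direction, the planar numerics `RootRunOK`, three radius facts, the cube radius `rQ 0 0 ≤ E₀`, the level numerics, the counts at accuracy
`δr 44`, the inputs at the running parameter (`hstd` at scale `M`; `hlink` at the route scales `[ℓ₀, t + R']` and at the first-hop scale `ℓR`),
the excess radius `R₁ ≤ Rt - L'` at `q`, and the first-hop prism at the root (`frameSeq γ v (γ w₀) (msel (γ w₀)) ⊆ Q_0(0)`, its scale-`ℓR`
prism inside the cut root world, its landing quarter-face on the start row). [cite: KozmaNitzan2024, §4 p. 28 ((32) at the root), Lemma 11] -/
theorem rootOblA_concG_raw (C : PCells) (w₀ : W) (Λ : ConcRadiiG) (q : unitInterval) (δc : ℝ) {Δ' : ℕ} {δr : ℕ → ℝ}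
    {Rt L' t R' ℓ₀ Rlev N j₀ j₁ E₀ ℓR : ℕ} {ca cb q' : MDir → ℤ} (hOK : ∀ du, RootRunOK C t R' ℓ₀ (ca du) (cb du) (q' du))
    (hRl : Rlev + 1 ≤ R') (hj : j₁ ≤ Rlev)
    (hRB : ∀ du, Rt ≤ Λ.rB 0 0 du) (hRQ : ∀ du, Rt ≤ Λ.rQ 0 ((0 : Site 2) + stepVec du))
    (hRM : ∀ du, Rt ≤ Λ.rM 0 ((0 : Site 2) + stepVec du)) (hQ0 : Λ.rQ 0 0 ≤ E₀) (hE₀R : E₀ ≤ Rt)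
    (hcount : 1 / (1 - (q : ℝ)) ^ (Δ' * N) ≤ δr 44 * ((Finset.Icc j₀ j₁).card : ℝ))
    {Δ : ℕ} (hΔ : ∀ w, X.degree w ≤ Δ) {p₀ : unitInterval} (hT : TubeSubcritical X p₀) (V₀ : Finset W) (hfr : ∀ w : W, ∃ γ : X ≃g X, γ w ∈ V₀)
    (hδr : 0 < δr 44) (hδr1 : δr 44 ≤ 1) {msel : W → ℕ} {M : ℕ} (hmsel : ∀ τ ∈ V₀, msel τ ≤ M)
    (hstd : ∀ τ ∈ V₀,
      1 - δr 44 ^ 2 < (bondPercolation (X □ zdGraph 2) q).real (UniqZone.zone (X □ zdGraph 2) (ufatSeq X hT V₀ τ) (msel τ) M) ∧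
      ∀ g : HOct 2, 1 - δr 44 ^ 2 < (bondPercolation (X □ zdGraph 2) q).real
        (linkIn (↑(ufatSeq X hT V₀ τ M)) (ufatSeq X hT V₀ τ (msel τ)) (ballFin X τ (ufatRadius X hT V₀ M) ×ˢ piece g M)))
    (hMℓ : M < ℓ₀)
    (hlink : ∀ ℓ, ℓ₀ ≤ ℓ → ℓ ≤ t + R' → ∀ τ ∈ V₀, ∀ g : HOct 2, 1 - δr 44 ^ 2 < (bondPercolation (X □ zdGraph 2) q).real
      (linkIn (↑(ufatSeq X hT V₀ τ ℓ)) (ufatSeq X hT V₀ τ (msel τ)) (ballFin X τ (ufatRadius X hT V₀ ℓ) ×ˢ piece g ℓ)))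
    (hlinkR : ∀ τ ∈ V₀, ∀ g : HOct 2, 1 - δr 44 ^ 2 < (bondPercolation (X □ zdGraph 2) q).real
      (linkIn (↑(ufatSeq X hT V₀ τ ℓR)) (ufatSeq X hT V₀ τ (msel τ)) (ballFin X τ (ufatRadius X hT V₀ ℓR) ×ˢ piece g ℓR)))
    (hnF : ufatRadius X hT V₀ M ≤ Rt) (hLψ : ufatRadius X hT V₀ (t + R') + ufatRadius X hT V₀ M ≤ L') (hLR : L' ≤ Rt)
    (hψR : ufatRadius X hT V₀ ℓR ≤ Rt)
    (hj₀ : M + 1 ≤ j₀) (kk : ℕ) (hN : kk * kitB Δ M (ufatRadius X hT V₀ M) ≤ N)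
    (hk : (1 - (q : ℝ) ^ kitSB Δ M (ufatRadius X hT V₀ M)) ^ kk ≤ δr 44)
    {η : ℝ} (hη : η ≤ δr 44 / 2) {R₁ : ℕ}
    (hR₁ : ∀ R'', R₁ ≤ R'' → ∀ τ ∈ ({w₀} : Finset W), ∀ (Rw : ℕ) (D' A' : Finset (W × Site 2)),
      D' ⊆ ballFin X τ Rw ×ˢ box 2 (25 * C.r) → A' ⊆ D' → (∀ a ∈ A', a.1 ∈ ballFin X τ (E₀ + 1)) →
      (bondPercolation (X □ zdGraph 2) q).real (excess X τ R'' D' A') ≤ η)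
    (hR : R₁ ≤ Rt - L')
    -- the first hop at the root
    (γ : X ≃g X) (hγ : γ w₀ ∈ V₀) (v : MDir → Site 2) (τ' : MDir → Fin 2 → ℤˣ)
    (hin : ∀ du, frameSeq X hT V₀ γ (v du) (γ w₀) (msel (γ w₀)) ⊆ (cellGeomCG X C w₀ Λ).Q 0 0)
    (hℓU : ∀ du, frameSeq X hT V₀ γ (v du) (γ w₀) ℓR ⊆ rootU X C w₀ Λ q δc Rt du)
    (hBpl : ∀ du, (orthantFace du.1 (τ' du) ℓR).image (fun s => s + v du) ⊆
      Adv.core 0 (q' du) (t : ℤ) R' du.1 (sgOf du) (rootCtr du (ca du) (cb du)) 0) :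
    KSchA.RootOblA X (concSchemeG X C w₀ Λ q δc) Δ' δr := by
  refine rootOblA_of_rootRun X C w₀ Λ q δc hOK hRl hj
    (fun du => rootTAD X w₀ Rt L' du t R' ℓ₀ (ca du) (cb du) (q' du) Rlev N j₀ j₁ (rootU X C w₀ Λ q δc Rt du)) (fun du => rfl)
    hRB hRQ hRM (fun du => hcount) (fun du => ?_) (η := η) (fun du => hη) (fun du k hk => ?_)
    (π₀ := fun _ => ballFin X w₀ (ufatRadius X hT V₀ ℓR)) (Bpl := fun du => (orthantFace du.1 (τ' du) ℓR).image (fun s => s + v du))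
    (fun du => ballFin_mono X w₀ hψR) hBpl (fun du => ?_)
  · -- the kit clauses
    exact hkits_rootTAD X (hOK du) (hRB du) (hRQ du) hRl hj hΔ hT V₀ hfr hδr hmsel hstd hMℓ hlink hnF hLψ hLR hj₀ kk hN hk
  · -- the rim excess
    exact real_rim_le_root X (hOK du) (hRB du) (hRQ du) hQ0 hR₁ hR hk
  · -- the first hop
    have hQU : (cellGeomCG X C w₀ Λ).Q 0 0 ⊆ rootU X C w₀ Λ q δc Rt du := fun z hz =>
      Finset.mem_filter.2 ⟨Finset.mem_union_left _ hz, by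
        change z ∈ ballFin X w₀ (Λ.rQ 0 0) ×ˢ C.Q 0 at hz
        exact ballFin_mono X w₀ (hQ0.trans hE₀R) (Finset.mem_product.1 hz).1⟩
    have h1 := root_hsrc' X (q := q) (δc := δc) hT V₀ hlinkR hQU γ hγ (v du) (hin du) (hℓU du) du.1 (τ' du)
    refine lt_of_le_of_lt ?_ h1
    have hsq : δr 44 ^ 2 ≤ δr 44 := by nlinarith [hδr, hδr1]
    show 1 - δr 44 ≤ 1 - δr 44 ^ 2
    linarith

/-! ## §4 The radius facts of the schedule of record at the root -/

/-- **The root radius facts of `concRadiiGB`** with `Rt := F 1 - L'`: `rB 0 0 du = F 1`, `rQ 0 (0 + du) = E 1`, `rM 0 (0 + du) = F 1 - L'`,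
`rQ 0 0 = E₀`. [cite: KozmaNitzan2024, §4 p. 28] -/
theorem root_radii_concRadiiGB (C : PCells) (gap gap' : ℕ → ℕ) (E₀ L' : ℕ) (du : MDir) :
    Frad gap gap' E₀ 1 - L' ≤ (concRadiiGB C gap gap' E₀ L').rB 0 0 du ∧
      Frad gap gap' E₀ 1 - L' ≤ (concRadiiGB C gap gap' E₀ L').rQ 0 ((0 : Site 2) + stepVec du) ∧
      Frad gap gap' E₀ 1 - L' ≤ (concRadiiGB C gap gap' E₀ L').rM 0 ((0 : Site 2) + stepVec du) ∧
      (concRadiiGB C gap gap' E₀ L').rQ 0 0 ≤ E₀ := by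
  have h1 : nQ 0 ((0 : Site 2) + stepVec du) = 1 := by rw [zero_add, nQ, if_pos rfl, gen0_stepVec]
  have h0 : nS 0 (0 : Site 2) = 0 := by rw [nS, if_pos rfl, if_pos rfl]
  have h00 : nQ 0 (0 : Site 2) = 0 := by rw [nQ, if_pos rfl, gen0_zero]
  refine ⟨?_, ?_, ?_, ?_⟩
  · rw [concRadiiGB_rB, concRadiiGB_rE, h0, h1, zero_add, min_eq_left (Frad_le_Erad gap gap' E₀ 1)]
    exact Nat.sub_le _ _
  · rw [concRadiiGB_rQ, h1]
    exact (Nat.sub_le _ _).trans (Frad_le_Erad gap gap' E₀ 1)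
  · rw [concRadiiGB_rM, h1]
  · rw [concRadiiGB_rQ, h00, Erad_zero]

end BoxProdZ2

end Transplant

end Summit.CriticalPhenomena.PercolationContinuityZ3.Theorems

end
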